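/-
Copyright (c) 2026 the pub-hodgecm-mathlib formalisation cell (harness21).  Prover seat hodgecm-mathlib-A-p03 (g26); road «W′ = R1LL-WILD» (architect A-p16 (g28) RULINGS A-32, A-33,
A-35 (b) «(W′5′-LC)»; LEAD F0P3a-plan (g10) WORD T9-25), FILE 1 of 2 (generic local field half), 2026-09-01.
-/
import Literature.NumberTheory.QuadraticForms.GlobalSquareTheorem            -- ★ `isSquare_div_of_valued_sub_lt` (O'Meara 63:1b, dyadic places included)
import Literature.NumberTheory.QuadraticForms.HilbertReciprocityFiniteness   -- ★ `hilbertSymbol_mul_sq_left` ∕ `_right`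
import HarnessLib

/-!
# The Hilbert symbol `(x, θ)_v` is LOCALLY CONSTANT in each slot on `K_v^×` — at EVERY finite place, dyadic included (O'Meara §63A–B)

Topic `NumberTheory/QuadraticForms`; namespace `Literature.NumberTheory.QuadraticForms`.  THEOREMS ONLY (no definition, no instance, no notation, no named fact, no `sorry`).
Cell `pub/hodgecm-mathlib` (D-0151), crux H413 = `stmt-HodgeConjecture-24833`, road «W′ = R1LL-WILD» (the rank-one unstable transfer letter at the WILDLY ramified places):
architect A-p16 (g28) RULING A-32 types the Δ-side weight of the Labesse–Langlands germ expansion AS a Hilbert symbol `(b(t), θ)_v` (never evaluated), and RULING A-35 (b)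
asks for «`t ↦ (trc t, θ)_v` is eventually constant» — whose local-field half is this file.  HONEST LABEL: HC_CM is proved only modulo the printed citations (hLiu418, h413)
until rung 0 closes; this file is elementary local algebra and asserts nothing printed.

THE POINT.  `K_v^{×2}` is OPEN in `K_v` at every finite place `v` — quantitatively `v(x − c) < v(4c) ⇒ x∕c ∈ K_v^{×2}` (★ `isSquare_div_of_valued_sub_lt`, Hensel at `2` built in
through `1 + 4m`, `v(m) < 1`) — and the Hilbert symbol only sees square classes (★ `hilbertSymbol_mul_sq_left`).  Hence:
* §1 `hilbertSymbol_eq_of_valued_sub_lt (hc : c ≠ 0) (h : v(x − c) < v(4c)) (θ) : (x, θ)_v = (c, θ)_v` (+ `_right`);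
* §2 `setOf_valued_sub_lt_four_mul_mem_nhds` (the ball is a neighbourhood), `eventually_hilbertSymbol_eq (hc) (θ) : ∀ᶠ x in 𝓝 c, (x, θ)_v = (c, θ)_v` (+ `_right`), and the
  composite forms `Filter.Tendsto.hilbertSymbol_eventually_eq` ∕ `ContinuousAt.hilbertSymbol_eventually_eq[_right∕₂]` — «a Hilbert symbol of a continuous non-vanishing
  argument is eventually constant», the `hφ`∕`hE`-binder shape of the eventual-constancy layers (★ `RankOneTorusDepthContinuity`, ★ `RankOneTorusCoefficientLocalConstancy`);
* §3 `isLocallyConstant_hilbertSymbol_units[_right]` : `u ↦ (↑u, θ)_v` is locally constant on `K_vˣ`.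
The radius is `|4c|_v` (two extra shells at `v ∣ 2`, none elsewhere); nothing here assumes `2 ∤ v`.

## References
* [Omeara1963] O. T. O'Meara, *Introduction to Quadratic Forms* (1963), §63A Cor. 63:1b (local squares are open), §63B (63:10–63:13a) (the Hilbert symbol on square classes).
* [Serre1973] J.-P. Serre, *A Course in Arithmetic* (1973), Ch. II §3.3, Ch. III §1.1 (`U_n ⊂ K^{×2}` for `n > 2·ord 2`; bimultiplicativity).
* [LabesseLanglands1979] J.-P. Labesse, R. P. Langlands, *L-indistinguishability for SL(2)*, Canad. J. Math. 31 (1979), §2 pp. 8–10 (the `κ`-weight is locally constant in `t`).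
-/

set_option autoImplicit false

noncomputable section

open IsDedekindDomain NumberField Filter Topology

namespace Literature.NumberTheory.QuadraticForms

variable (K : Type*) [Field K] [NumberField K] (v : HeightOneSpectrum (𝓞 K))

/-! ## §1 Close arguments have equal symbols -/

section Close

/-- **`v(x − c) < v(4c)` ⇒ `(x, θ)_v = (c, θ)_v`** (`c ≠ 0`; any finite place, dyadic included): `x = c·r²` by ★ `isSquare_div_of_valued_sub_lt`, then ★ `hilbertSymbol_mul_sq_left`.
[cite: Omeara1963, §63A Cor. 63:1b; §63B] -/
theorem hilbertSymbol_eq_of_valued_sub_lt {x c : v.adicCompletion K} (hc : c ≠ 0)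
    (h : Valued.v (x - c) < Valued.v (4 * c)) (θ : v.adicCompletion K) :
    hilbertSymbol (v.adicCompletion K) x θ = hilbertSymbol (v.adicCompletion K) c θ := by
  obtain ⟨r, hr⟩ := (isSquare_div_of_valued_sub_lt K v hc h).1
  have hx : x = c * r ^ 2 := by rw [sq, ← hr, mul_div_cancel₀ _ hc]
  have hr0 : r ≠ 0 := by
    rintro rfl
    rw [sq, mul_zero, mul_zero] at hx
    rw [hx, zero_sub, Valuation.map_neg, Valuation.map_mul] at h
    have h4 : Valued.v (4 : v.adicCompletion K) ≤ 1 := by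
      have e4 : ((4 : v.adicCompletionIntegers K) : v.adicCompletion K) = 4 := by norm_cast
      rw [← e4]; exact (4 : v.adicCompletionIntegers K).2
    exact absurd (lt_of_lt_of_le h (mul_le_of_le_one_left' h4)) (lt_irrefl _)
  rw [hx, hilbertSymbol_mul_sq_left c θ hr0]

/-- Right-slot twin: **`v(x − c) < v(4c)` ⇒ `(a, x)_v = (a, c)_v`**. [cite: Omeara1963, §63A Cor. 63:1b; §63B] -/
theorem hilbertSymbol_eq_of_valued_sub_lt_right {x c : v.adicCompletion K} (hc : c ≠ 0)
    (h : Valued.v (x - c) < Valued.v (4 * c)) (a : v.adicCompletion K) :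
    hilbertSymbol (v.adicCompletion K) a x = hilbertSymbol (v.adicCompletion K) a c := by
  rw [hilbertSymbol_comm a x, hilbertSymbol_eq_of_valued_sub_lt K v hc h a, hilbertSymbol_comm]

end Close

/-! ## §2 Neighbourhood ∕ filter forms -/

section Eventually

/-- The ball `{x | v(x − c) < v(4c)}` is a neighbourhood of `c ≠ 0` (valuation topology; current Mathlib states `Valued.mem_nhds` with `Valued.v.restrict`).
[cite: Omeara1963, §63A] -/
theorem setOf_valued_sub_lt_four_mul_mem_nhds {c : v.adicCompletion K} (hc : c ≠ 0) :
    {x : v.adicCompletion K | Valued.v (x - c) < Valued.v (4 * c)} ∈ 𝓝 c := by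
  haveI : CharZero (v.adicCompletion K) := charZero_of_injective_algebraMap (algebraMap K _).injective
  have h4c0 : (4 : v.adicCompletion K) * c ≠ 0 := mul_ne_zero (by norm_num) hc
  have h4c : (Valued.v : Valuation (v.adicCompletion K) _).restrict (4 * c) ≠ 0 := (Valuation.ne_zero_iff _).2 h4c0
  have hmem : {x : v.adicCompletion K | (Valued.v : Valuation (v.adicCompletion K) _).restrict (x - c) <
      (Units.mk0 _ h4c : (MonoidWithZeroHom.ValueGroup₀ (.ofClass (Valued.v : Valuation (v.adicCompletion K) _)))ˣ).1} ∈ 𝓝 c :=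
    (Valued.mem_nhds).2 ⟨Units.mk0 _ h4c, fun y hy => hy⟩
  filter_upwards [hmem] with x hx
  exact (Valuation.restrict_lt_iff _).1 hx

/-- **`x ↦ (x, θ)_v` IS EVENTUALLY CONSTANT at every `c ≠ 0`.** [cite: Omeara1963, §63A Cor. 63:1b; §63B] [cite: LabesseLanglands1979, §2 p. 9] -/
theorem eventually_hilbertSymbol_eq {c : v.adicCompletion K} (hc : c ≠ 0) (θ : v.adicCompletion K) :
    ∀ᶠ x in 𝓝 c, hilbertSymbol (v.adicCompletion K) x θ = hilbertSymbol (v.adicCompletion K) c θ := by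
  filter_upwards [setOf_valued_sub_lt_four_mul_mem_nhds K v hc] with x hx
  exact hilbertSymbol_eq_of_valued_sub_lt K v hc hx θ

/-- Right-slot twin: `x ↦ (a, x)_v` is eventually constant at every `c ≠ 0`. [cite: Omeara1963, §63A Cor. 63:1b; §63B] -/
theorem eventually_hilbertSymbol_eq_right {c : v.adicCompletion K} (hc : c ≠ 0) (a : v.adicCompletion K) :
    ∀ᶠ x in 𝓝 c, hilbertSymbol (v.adicCompletion K) a x = hilbertSymbol (v.adicCompletion K) a c := by
  filter_upwards [setOf_valued_sub_lt_four_mul_mem_nhds K v hc] with x hx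
  exact hilbertSymbol_eq_of_valued_sub_lt_right K v hc hx a

/-- **A Hilbert symbol of an argument TENDING to `c ≠ 0` is eventually `(c, θ)_v`** (any filter; `Filter.Tendsto.eventually`). [cite: Omeara1963, §63B] [cite: LabesseLanglands1979, §2 p. 9] -/
theorem hilbertSymbol_eventually_eq_of_tendsto {α : Type*} {l : Filter α} {f : α → v.adicCompletion K} {c : v.adicCompletion K}
    (hf : Tendsto f l (𝓝 c)) (hc : c ≠ 0) (θ : v.adicCompletion K) :
    ∀ᶠ a in l, hilbertSymbol (v.adicCompletion K) (f a) θ = hilbertSymbol (v.adicCompletion K) c θ :=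
  hf.eventually (eventually_hilbertSymbol_eq K v hc θ)

/-- **A Hilbert symbol of a CONTINUOUS NON-VANISHING argument is eventually constant**: `f` continuous at `s`, `f s ≠ 0` ⇒ `∀ᶠ x in 𝓝 s, (f x, θ)_v = (f s, θ)_v` — the
`hE`∕`hφ`-binder shape of the eventual-constancy layers. [cite: LabesseLanglands1979, §2 p. 9] [cite: Omeara1963, §63B] -/
theorem hilbertSymbol_comp_eventually_eq {X : Type*} [TopologicalSpace X] {f : X → v.adicCompletion K} {s : X}
    (hf : ContinuousAt f s) (hs : f s ≠ 0) (θ : v.adicCompletion K) :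
    ∀ᶠ x in 𝓝 s, hilbertSymbol (v.adicCompletion K) (f x) θ = hilbertSymbol (v.adicCompletion K) (f s) θ :=
  hilbertSymbol_eventually_eq_of_tendsto K v hf hs θ

/-- Right-slot twin of `hilbertSymbol_comp_eventually_eq`. [cite: Omeara1963, §63B] -/
theorem hilbertSymbol_comp_eventually_eq_right {X : Type*} [TopologicalSpace X] {g : X → v.adicCompletion K} {s : X}
    (hg : ContinuousAt g s) (hs : g s ≠ 0) (a : v.adicCompletion K) :
    ∀ᶠ x in 𝓝 s, hilbertSymbol (v.adicCompletion K) a (g x) = hilbertSymbol (v.adicCompletion K) a (g s) :=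
  hg.eventually (eventually_hilbertSymbol_eq_right K v hs a)

/-- Both slots moving: `f, g` continuous at `s` and non-vanishing there ⇒ `∀ᶠ x in 𝓝 s, (f x, g x)_v = (f s, g s)_v`. [cite: Omeara1963, §63B] -/
theorem hilbertSymbol_comp_eventually_eq₂ {X : Type*} [TopologicalSpace X] {f g : X → v.adicCompletion K} {s : X}
    (hf : ContinuousAt f s) (hg : ContinuousAt g s) (hfs : f s ≠ 0) (hgs : g s ≠ 0) :
    ∀ᶠ x in 𝓝 s, hilbertSymbol (v.adicCompletion K) (f x) (g x) = hilbertSymbol (v.adicCompletion K) (f s) (g s) := by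
  filter_upwards [hf.eventually (setOf_valued_sub_lt_four_mul_mem_nhds K v hfs), hg.eventually (setOf_valued_sub_lt_four_mul_mem_nhds K v hgs)] with x hx hy
  rw [hilbertSymbol_eq_of_valued_sub_lt K v hfs hx, hilbertSymbol_eq_of_valued_sub_lt_right K v hgs hy]

end Eventually

/-! ## §3 `IsLocallyConstant` readings on the unit group -/

section LocallyConstant

/-- **`u ↦ (↑u, θ)_v` is locally constant on `K_vˣ`.** [cite: Omeara1963, §63A Cor. 63:1b; §63B] [cite: Serre1973, Ch. III §1.1] -/
theorem isLocallyConstant_hilbertSymbol_units (θ : v.adicCompletion K) :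
    IsLocallyConstant fun u : (v.adicCompletion K)ˣ => hilbertSymbol (v.adicCompletion K) (u : v.adicCompletion K) θ := by
  refine (IsLocallyConstant.iff_eventually_eq _).2 fun u => ?_
  exact hilbertSymbol_comp_eventually_eq K v (Units.continuous_val.continuousAt) u.ne_zero θ

/-- Right-slot twin: `u ↦ (a, ↑u)_v` is locally constant on `K_vˣ`. [cite: Omeara1963, §63B] -/
theorem isLocallyConstant_hilbertSymbol_units_right (a : v.adicCompletion K) :
    IsLocallyConstant fun u : (v.adicCompletion K)ˣ => hilbertSymbol (v.adicCompletion K) a (u : v.adicCompletion K) := by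
  refine (IsLocallyConstant.iff_eventually_eq _).2 fun u => ?_
  exact hilbertSymbol_comp_eventually_eq_right K v (Units.continuous_val.continuousAt) u.ne_zero a

end LocallyConstant

end Literature.NumberTheory.QuadraticForms

end
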